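import Literature.ModelTheory.ExponentialFields.Wilkie1989StepC
import Literature.ModelTheory.ExponentialFields.Wilkie1989LiftChain
import Literature.ModelTheory.ExponentialFields.Wilkie1989PermChain
import HarnessLib

/-!
# Wilkie 1989, §6: the proof of Theorem 2 — preparations (pp. 403–405), the induction, and the theorem

Trunk `TranscendEllArithS`, family `periods` (periods.S28): the leaf
`Literature.ModelTheory.ExponentialFields.Wilkie1989_expAlgebraicPoints_mem` (`Wilkie1989.lean`;
§6 of A. J. Wilkie, *On the theory of the real exponential field*, Illinois J. Math. 33 (1989),
384–408): the discharge `Wilkie1989_expAlgebraicPoints_mem_holds`.  (Khovanskii's finiteness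
theorem for square systems, which the argument uses, is a theorem of the tree:
`KhovanskiiZeroBound.lean`, transferred in `Wilkie1989StepC.lean`.)

* **Step B** (p. 405, `RealExpModel.stepB`): from the "prepared form" reached on p. 404
  (`g₁, …, gₙ₋₁ ∈ M`, `gₙ = 1 + Σᵢ₌₁^{s+1} aᵢ e^{ig}`) — permute the variables so that
  `det ∂(g₁, …, gₙ₋₁)/∂(x₂, …, xₙ)(ᾱ) ≠ 0` (`Wilkie1989PermChain.lean`), de-singularize `det J`
  and `p(e^g) = (det J) gₙ* e^{-g}` with two new variables (`Wilkie1989LiftChain.lean`), and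
  apply the curve argument `RealExpModel.stepC` (`Wilkie1989StepC.lean`).
* **Step A** (pp. 403–404, inside `RealExpModel.mainStep`): Lemma 2 at `ᾱ`; the cases
  `a₀(ᾱ) = 0` (conclude by the inductive hypothesis, possibly after dividing `hₙ - a₀` by `e^g`)
  and `a₀(ᾱ) ≠ 0` (adjoin `xₙ₊₁ = a₀⁻¹`: `u = xₙ₊₁ a₀ - 1`, `f = 1 + xₙ₊₁ (hₙ - a₀)`), reaching
  the prepared form.
* **The induction** on `(j, s)` (p. 403, `P_{j,s}`; here `RealExpModel.allStages`,
  `RealExpModel.allDegrees`) with the polynomial base case (`Wilkie1989HeightZero.lean`), and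
* **the theorem** `Wilkie1989_expAlgebraicPoints_mem_holds`.

## References

* A. J. Wilkie, *On the theory of the real exponential field*, Illinois J. Math. 33 (1989),
  384–408: §6, pp. 403–407.
-/

noncomputable section

open FirstOrder FirstOrder.Language FirstOrder.Language.Structure
open Set Polynomial

namespace Literature.ModelTheory.ExponentialFields

namespace RealExpModel

variable {k K : Language.Theory.ModelType.{0, 0, 0} realExpTheory}
  {f : k ↪[Language.orderedExpRing] K} {n : ℕ}

/-! ### Degrees: monotonicity, products with the generator, derivatives -/

section Degrees

variable {M : Subring (termFnRing f n)} {Y : termFnRing f n}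

/-- Weakening the degree bound. [folklore] -/
theorem DegLT.of_le {G : termFnRing f n} {s s' : ℕ} (h : DegLT M Y G s) (hss : s ≤ s') :
    DegLT M Y G s' := by
  obtain ⟨P, hP, hPG⟩ := h
  exact ⟨P, lt_of_lt_of_le hP hss, hPG⟩

/-- Degree `< s` is closed under multiplication by elements of `M` on the left. [folklore] -/
theorem DegLT.mem_mul {G m : termFnRing f n} {s : ℕ} (h : DegLT M Y G s) (hm : m ∈ M) :
    DegLT M Y (m * G) s := by
  rw [mul_comm]; exact h.mul_mem hm

/-- Multiplying by the generator raises the degree by one. [folklore] -/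
theorem DegLT.mul_gen {G : termFnRing f n} {s : ℕ} (h : DegLT M Y G s) : DegLT M Y (G * Y) (s + 1) := by
  obtain ⟨P, hP, rfl⟩ := h
  refine ⟨P * X, ?_, by simp [Polynomial.map_mul]⟩
  calc (P * X).natDegree ≤ P.natDegree + 1 := natDegree_mul_le.trans (by simp)
    _ < s + 1 := by omega

/-- `1` has degree `< s` for `s ≥ 1`. [folklore] -/
theorem degLT_one {s : ℕ} (hs : 0 < s) : DegLT M Y (1 : termFnRing f n) s :=
  degLT_of_mem M.one_mem hs

end Degrees

/-- **Derivatives do not raise the degree** (the computation behind "`∂gₙ/∂xᵢ = e^g Pᵢ(e^g)`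
where `Pᵢ` … are polynomials over `M` of degree `≤ s`", p. 405): for `G` of degree `< s` over
`M_J` (`J ≥ n`), `∂G/∂xₗ` has degree `< s`. [cite: Wilkie1989, §6, p. 405] -/
theorem DegLT.pd' {g : ℕ → termFnRing f n} (hg : ∀ i, n ≤ i → g i ∈ chain f n g i) {J : ℕ}
    (hJ : n ≤ J) {G : termFnRing f n} {s : ℕ}
    (h : DegLT (chain f n g J) (chainGen f n g J) G s) (l : Fin n) :
    DegLT (chain f n g J) (chainGen f n g J) (pd f n l G) s := by
  obtain ⟨P, hP, rfl⟩ := h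
  have hs : 0 < s := lt_of_le_of_lt (Nat.zero_le _) hP
  have hM : ∀ m ∈ chain f n g J, pd f n l m ∈ chain f n g J := fun m hm => pd_mem_chain f n g hg hm l
  set Y := chainGen f n g J with hY
  rw [pd_eval, sum_pd_eq, ← eval_pdPoly l hM P, Polynomial.derivative_map, Polynomial.eval_map,
    ← Polynomial.eval_map]
  refine DegLT.add ⟨pdPoly l hM P, lt_of_le_of_lt (natDegree_pdPoly_le l hM P) hP, rfl⟩ ?_
  -- the term `P'(Y) · ∂Y/∂xₗ = P'(Y) · Y · ∂g_J/∂xₗ`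
  have hdY : pd f n l Y = Y * pd f n l (g J) := by rw [hY, chainGen_of_le f n g hJ, pd_expFn]
  rw [hdY, ← mul_assoc]
  refine DegLT.mul_mem ?_ (pd_mem_chain f n g hg (hg J hJ) l)
  by_cases hP0 : P.natDegree = 0
  · rw [Polynomial.derivative_of_natDegree_zero hP0, Polynomial.map_zero, eval_zero, zero_mul]
    exact degLT_zero hs
  · have hdeg : (derivative P).natDegree < s - 1 :=
      lt_of_le_of_lt (natDegree_derivative_le P) (by omega)
    have h1 : DegLT (chain f n g J) Y (((derivative P).map (chain f n g J).subtype).eval Y) (s - 1) :=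
      degLT_eval hdeg
    have := h1.mul_gen
    rwa [Nat.sub_add_cancel hs] at this

/-! ### Linear algebra: extending independent families by a new last coordinate -/

section LinAlg

variable {L : Type*} [Field L] {N p : ℕ}

/-- Vectors in the span of vectors with vanishing last coordinate have vanishing last coordinate.
[folklore] -/
theorem apply_last_eq_zero_of_mem_span {v : Fin p → Fin (N + 1) → L} (hv : ∀ i, v i (Fin.last N) = 0)
    {w : Fin (N + 1) → L} (hw : w ∈ Submodule.span L (Set.range v)) : w (Fin.last N) = 0 := by
  induction hw using Submodule.span_induction with
  | mem x hx => obtain ⟨i, rfl⟩ := hx; exact hv i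
  | zero => rfl
  | add x y _ _ hx hy => simp [hx, hy]
  | smul a x _ hx => simp [hx]

/-- **Extension by a vector with non-zero last coordinate**: if the `vᵢ` have last coordinate `0`
and are independent, and `w` has non-zero last coordinate, then `(v₁, …, vₚ, w)` is independent.
[folklore] -/
theorem linearIndependent_snoc_of_last {v : Fin p → Fin (N + 1) → L} (hv : LinearIndependent L v)
    (hv0 : ∀ i, v i (Fin.last N) = 0) {w : Fin (N + 1) → L} (hw : w (Fin.last N) ≠ 0) :
    LinearIndependent L (Fin.snoc v w) := by
  rw [linearIndependent_finSnoc]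
  exact ⟨hv, fun hmem => hw (apply_last_eq_zero_of_mem_span hv0 hmem)⟩

/-- Padding by a zero last coordinate preserves independence. [folklore] -/
theorem linearIndependent_snoc_zero {u : Fin p → Fin N → L} (hu : LinearIndependent L u) :
    LinearIndependent L fun i => (Fin.snoc (u i) 0 : Fin (N + 1) → L) := by
  rw [Fintype.linearIndependent_iff] at hu ⊢
  intro c hc i
  refine hu c (funext fun j => ?_) i
  have := congrFun hc (Fin.castSucc j)
  simpa [Finset.sum_apply, Fin.snoc_castSucc] using this

/-- `(snoc v 0) ∘ succ = snoc (v ∘ succ) 0`. [folklore] -/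
theorem snoc_zero_comp_succ (v : Fin (N + 1) → L) :
    ((Fin.snoc v (0 : L) : Fin (N + 2) → L) ∘ Fin.succ) = Fin.snoc (v ∘ Fin.succ) 0 := by
  funext j
  refine Fin.lastCases ?_ (fun j => ?_) j
  · simp only [Function.comp_apply, Fin.succ_last, Fin.snoc_last]
  · simp only [Function.comp_apply, Fin.snoc_castSucc]
    rw [show (Fin.castSucc j).succ = Fin.castSucc j.succ from rfl, Fin.snoc_castSucc]

end LinAlg

/-! ### Gradient rows: algebra -/

section JRow

variable (f n)

/-- Gradient rows of a product. [folklore] -/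
theorem jrow_mul' (F G : termFnRing f n) (x : Fin n → K) :
    jrow f n (F * G) x = ((G : (Fin n → K) → K) x) • jrow f n F x + ((F : (Fin n → K) → K) x) • jrow f n G x := by
  funext l
  simp only [jrow, pd_mul, Pi.add_apply, Pi.smul_apply, smul_eq_mul]
  push_cast
  simp only [Pi.add_apply, Pi.mul_apply]
  ring

/-- Gradient rows of a sum. [folklore] -/
theorem jrow_add' (F G : termFnRing f n) (x : Fin n → K) :
    jrow f n (F + G) x = jrow f n F x + jrow f n G x := by
  funext l
  simp only [jrow, pd_add, Pi.add_apply]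
  push_cast
  rfl

/-- Gradient rows of a difference. [folklore] -/
theorem jrow_sub' (F G : termFnRing f n) (x : Fin n → K) :
    jrow f n (F - G) x = jrow f n F x - jrow f n G x := by
  funext l
  simp only [jrow, sub_eq_add_neg, pd_add, pd_neg, Pi.sub_apply]
  push_cast
  rfl

/-- The gradient row of `1` vanishes. [folklore] -/
@[simp] theorem jrow_one' (x : Fin n → K) : jrow f n (1 : termFnRing f n) x = 0 := by
  funext l
  simp only [jrow, pd_one, Pi.zero_apply]
  rfl

/-- The gradient row of the coordinate function `xᵢ` is the `i`-th basis vector. [folklore] -/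
theorem jrow_coordFn' (i : Fin n) (x : Fin n → K) : jrow f n (coordFn f n i) x = Pi.single i 1 := by
  funext l
  simp only [jrow, pd_coordFn, Pi.single_apply]
  by_cases h : i = l
  · subst h; simp
  · rw [if_neg h, if_neg (Ne.symm h)]; rfl

variable {f n}

end JRow

/-! ### Step B: from the prepared form to the curve form (p. 405) -/

section StepB

variable {q : ℕ}

/-- **"By permuting variables if necessary"** (p. 405): an independent family of `q` gradient rows
in `q + 1` variables has a non-vanishing `q × q` minor omitting one column `l₀`; composing with the
transposition `(l₀ 0)` this is the minor on the columns `σ(1), …, σ(q)`. [cite: Wilkie1989, §6, p. 405] -/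
theorem exists_swap_minor_ne_zero (A : Matrix (Fin q) (Fin (q + 1)) K)
    (hA : LinearIndependent K (fun i => A i)) :
    ∃ l₀ : Fin (q + 1), (A.submatrix _root_.id fun j : Fin q => Equiv.swap l₀ 0 j.succ).det ≠ 0 := by
  classical
  obtain ⟨I, hI, hdet⟩ := exists_det_submatrix_ne_zero_of_linearIndependent_rows A hA
  have hns : ¬ Function.Surjective I := fun hs => by
    have := Fintype.card_le_of_surjective I hs
    simp at this
  obtain ⟨l₀, hl₀⟩ : ∃ l₀, ∀ i, I i ≠ l₀ := by
    by_contra h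
    push Not at h
    exact hns fun l => h l
  refine ⟨l₀, ?_⟩
  set σ : Equiv.Perm (Fin (q + 1)) := Equiv.swap l₀ 0 with hσ
  have hw : ∀ i, σ (I i) ≠ 0 := by
    intro i h0
    apply hl₀ i
    have : I i = σ.symm 0 := (Equiv.apply_eq_iff_eq_symm_apply σ).1 h0
    rw [this, hσ, Equiv.symm_swap, Equiv.swap_apply_right]
  set τ : Fin q → Fin q := fun i => (σ (I i)).pred (hw i) with hτ
  have hτI : ∀ i, σ (τ i).succ = I i := by
    intro i
    rw [hτ, Fin.succ_pred, hσ, Equiv.swap_apply_self]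
  have hτinj : Function.Injective τ := by
    intro i j hij
    apply hI
    rw [← hτI i, ← hτI j, hij]
  set τe : Equiv.Perm (Fin q) := Equiv.ofBijective τ (Finite.injective_iff_bijective.1 hτinj) with hτe
  have hsub : A.submatrix _root_.id I =
      (A.submatrix _root_.id fun j : Fin q => σ j.succ).submatrix _root_.id τe := by
    ext i j
    simp only [Matrix.submatrix_apply, id_eq, hτe, Equiv.ofBijective_apply, hτI]
  have hdet' : (A.submatrix _root_.id I).det =
      ((Equiv.Perm.sign τe : ℤ) : K) * (A.submatrix _root_.id fun j : Fin q => σ j.succ).det := by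
    rw [hsub, ← Matrix.det_transpose, Matrix.transpose_submatrix, Matrix.det_permute,
      Matrix.det_transpose]
  rw [hdet'] at hdet
  exact right_ne_zero_of_mul hdet

/-! #### Two extensions by a last coordinate -/

/-- The family obtained from `τ` by padding with a zero coordinate and appending a vector.
[folklore] -/
def ext1 {p N : ℕ} (τ : Fin p → Fin N → K) (w : Fin (N + 1) → K) : Fin (p + 1) → Fin (N + 1) → K :=
  @Fin.snoc p (fun _ => Fin (N + 1) → K) (fun i => @Fin.snoc N (fun _ => K) (τ i) 0) w

/-- **Block-triangular independence**: if `τ` is independent and the appended vector has non-zero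
new coordinate, `ext1 τ w` is independent. [folklore] -/
theorem linearIndependent_ext1 {p N : ℕ} {τ : Fin p → Fin N → K} (hτ : LinearIndependent K τ)
    {w : Fin (N + 1) → K} (hw : w (Fin.last N) ≠ 0) : LinearIndependent K (ext1 τ w) :=
  linearIndependent_snoc_of_last (linearIndependent_snoc_zero hτ) (fun i => by simp) hw

/-- The family obtained from `τ` by padding with two zero coordinates and appending two vectors.
[folklore] -/
def extFamily {p N : ℕ} (τ : Fin p → Fin N → K) (w₁ : Fin (N + 1) → K) (w₂ : Fin (N + 2) → K) :
    Fin (p + 2) → Fin (N + 2) → K :=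
  ext1 (ext1 τ w₁) w₂

/-- Independence of the double extension. [folklore] -/
theorem linearIndependent_extFamily {p N : ℕ} {τ : Fin p → Fin N → K} (hτ : LinearIndependent K τ)
    {w₁ : Fin (N + 1) → K} (hw₁ : w₁ (Fin.last N) ≠ 0) {w₂ : Fin (N + 2) → K}
    (hw₂ : w₂ (Fin.last (N + 1)) ≠ 0) : LinearIndependent K (extFamily τ w₁ w₂) :=
  linearIndependent_ext1 (linearIndependent_ext1 hτ hw₁) hw₂

/-! #### The de-singularized system in `q + 3` variables -/

variable (f)

/-- Lifting twice: a function of `x₁, …, x_{q+1}` as a function of `x₁, …, x_{q+3}`. [folklore] -/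
def LL (F : termFnRing f (q + 1)) : termFnRing f (q + 3) := liftFn f (q + 2) (liftFn f (q + 1) F)

/-- **The de-singularized curve system** (p. 405: "considering `g = x_{n+1} · det J - 1`" and
"considering `x_{n+1} · p(e^g) - 1`, etc."): `(e₁, …, e_q, x_{q+2} D - 1, x_{q+3} P - 1)` in the
variables `x₁, …, x_{q+3}`. [cite: Wilkie1989, §6, p. 405] -/
def desing (e : Fin q → termFnRing f (q + 1)) (D P : termFnRing f (q + 1)) :
    Fin (q + 2) → termFnRing f (q + 3) :=
  Fin.snoc (Fin.snoc (fun i => LL f (e i))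
      (liftFn f (q + 2) (coordFn f (q + 2) (Fin.last (q + 1)) * liftFn f (q + 1) D - 1)))
    (coordFn f (q + 3) (Fin.last (q + 2)) * LL f P - 1)

variable {f}

/-- Values of a doubly lifted function. [folklore] -/
@[simp] theorem coe_LL (F : termFnRing f (q + 1)) (x : Fin (q + 3) → K) :
    ((LL f F : termFnRing f (q + 3)) : (Fin (q + 3) → K) → K) x =
      (F : (Fin (q + 1) → K) → K) (Fin.init (Fin.init x)) := rfl

/-- Gradient rows of a doubly lifted function. [folklore] -/
theorem jrow_LL (F : termFnRing f (q + 1)) (x : Fin (q + 3) → K) :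
    jrow f (q + 3) (LL f F) x = Fin.snoc (Fin.snoc (jrow f (q + 1) F (Fin.init (Fin.init x))) 0) 0 := by
  rw [LL, jrow_liftFn, jrow_liftFn]

/-- `LL` is a ring homomorphism (composite of two). [folklore] -/
theorem LL_eq (F : termFnRing f (q + 1)) : LL f F = (liftFn f (q + 2)).comp (liftFn f (q + 1)) F := rfl

section DesingLemmas

variable (e : Fin q → termFnRing f (q + 1)) (D P : termFnRing f (q + 1))

/-- The curve equations of the de-singularized system. [folklore] -/
@[simp] theorem desing_castSucc_castSucc (i : Fin q) :
    desing f e D P (Fin.castSucc (Fin.castSucc i)) = LL f (e i) := by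
  simp [desing]

/-- The first de-singularizing equation. [folklore] -/
@[simp] theorem desing_castSucc_last :
    desing f e D P (Fin.castSucc (Fin.last q)) =
      liftFn f (q + 2) (coordFn f (q + 2) (Fin.last (q + 1)) * liftFn f (q + 1) D - 1) := by
  simp [desing]

/-- The second de-singularizing equation. [folklore] -/
@[simp] theorem desing_last :
    desing f e D P (Fin.last (q + 1)) = coordFn f (q + 3) (Fin.last (q + 2)) * LL f P - 1 := by
  simp [desing]

/-- Value of the first de-singularizing equation: `x_{q+2} D(x̄) - 1`. [folklore] -/
theorem coe_desing_castSucc_last (x : Fin (q + 3) → K) :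
    ((desing f e D P (Fin.castSucc (Fin.last q)) : termFnRing f (q + 3)) : (Fin (q + 3) → K) → K) x =
      x (Fin.castSucc (Fin.last (q + 1))) * (D : (Fin (q + 1) → K) → K) (Fin.init (Fin.init x)) - 1 := by
  rw [desing_castSucc_last, coe_liftFn]
  simp only [AddSubgroupClass.coe_sub, Subring.coe_mul, Pi.sub_apply, Pi.mul_apply, coe_coordFn,
    OneMemClass.coe_one, Pi.one_apply, coe_liftFn]
  rfl

/-- Value of the second de-singularizing equation: `x_{q+3} P(x̄) - 1`. [folklore] -/
theorem coe_desing_last (x : Fin (q + 3) → K) :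
    ((desing f e D P (Fin.last (q + 1)) : termFnRing f (q + 3)) : (Fin (q + 3) → K) → K) x =
      x (Fin.last (q + 2)) * (P : (Fin (q + 1) → K) → K) (Fin.init (Fin.init x)) - 1 := by
  rw [desing_last]
  simp only [AddSubgroupClass.coe_sub, Subring.coe_mul, Pi.sub_apply, Pi.mul_apply, coe_coordFn,
    OneMemClass.coe_one, Pi.one_apply, coe_LL]

/-- The first appended gradient row (before padding). [folklore] -/
def W₁ (x : Fin (q + 3) → K) : Fin (q + 2) → K :=
  (D : (Fin (q + 1) → K) → K) (Fin.init (Fin.init x)) • Pi.single (Fin.last (q + 1)) 1 +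
    x (Fin.castSucc (Fin.last (q + 1))) • Fin.snoc (jrow f (q + 1) D (Fin.init (Fin.init x))) 0

/-- The second appended gradient row. [folklore] -/
def W₂ (x : Fin (q + 3) → K) : Fin (q + 3) → K :=
  (P : (Fin (q + 1) → K) → K) (Fin.init (Fin.init x)) • Pi.single (Fin.last (q + 2)) 1 +
    x (Fin.last (q + 2)) • Fin.snoc (Fin.snoc (jrow f (q + 1) P (Fin.init (Fin.init x))) 0) 0

/-- Gradient row of the first de-singularizing equation. [folklore] -/
theorem jrow_desing_castSucc_last (x : Fin (q + 3) → K) :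
    jrow f (q + 3) (desing f e D P (Fin.castSucc (Fin.last q))) x = Fin.snoc (W₁ D x) 0 := by
  rw [desing_castSucc_last, jrow_liftFn, jrow_sub', jrow_one', sub_zero, jrow_mul', jrow_coordFn',
    jrow_liftFn, coe_liftFn, coe_coordFn, W₁]
  rfl

/-- Gradient row of the second de-singularizing equation. [folklore] -/
theorem jrow_desing_last (x : Fin (q + 3) → K) :
    jrow f (q + 3) (desing f e D P (Fin.last (q + 1))) x = W₂ P x := by
  rw [desing_last, jrow_sub', jrow_one', sub_zero, jrow_mul', jrow_coordFn', jrow_LL, coe_coordFn, W₂,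
    coe_LL]

/-- The last coordinate of `W₁`. [folklore] -/
theorem W₁_last (x : Fin (q + 3) → K) :
    W₁ D x (Fin.last (q + 1)) = (D : (Fin (q + 1) → K) → K) (Fin.init (Fin.init x)) := by
  simp [W₁]

/-- The last tail coordinate of `W₁`. [folklore] -/
theorem W₁_succ_last (x : Fin (q + 3) → K) :
    (W₁ D x ∘ Fin.succ) (Fin.last q) = (D : (Fin (q + 1) → K) → K) (Fin.init (Fin.init x)) := by
  rw [Function.comp_apply, Fin.succ_last, W₁_last]

/-- The last coordinate of `W₂`. [folklore] -/
theorem W₂_last (x : Fin (q + 3) → K) :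
    W₂ P x (Fin.last (q + 2)) = (P : (Fin (q + 1) → K) → K) (Fin.init (Fin.init x)) := by
  simp [W₂]

/-- The last tail coordinate of `W₂`. [folklore] -/
theorem W₂_succ_last (x : Fin (q + 3) → K) :
    (W₂ P x ∘ Fin.succ) (Fin.last (q + 1)) = (P : (Fin (q + 1) → K) → K) (Fin.init (Fin.init x)) := by
  rw [Function.comp_apply, Fin.succ_last, W₂_last]

/-- **The points of `V(desing)`**: the old coordinates lie on `V(e)`, and `x_{q+2} D = 1`,
`x_{q+3} P = 1`. [folklore] -/
theorem mem_VF_desing_iff (x : Fin (q + 3) → K) :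
    x ∈ VF f (q + 3) (desing f e D P) ↔
      Fin.init (Fin.init x) ∈ VF f (q + 1) e ∧
        x (Fin.castSucc (Fin.last (q + 1))) * (D : (Fin (q + 1) → K) → K) (Fin.init (Fin.init x)) = 1 ∧
        x (Fin.last (q + 2)) * (P : (Fin (q + 1) → K) → K) (Fin.init (Fin.init x)) = 1 := by
  simp only [mem_VF]
  constructor
  · intro hx
    refine ⟨fun i => ?_, ?_, ?_⟩
    · have := hx (Fin.castSucc (Fin.castSucc i)); rwa [desing_castSucc_castSucc, coe_LL] at this
    · have := hx (Fin.castSucc (Fin.last q)); rw [coe_desing_castSucc_last] at this; exact sub_eq_zero.1 this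
    · have := hx (Fin.last (q + 1)); rw [coe_desing_last] at this; exact sub_eq_zero.1 this
  · rintro ⟨hxe, hxD, hxP⟩ i
    refine Fin.lastCases ?_ (fun i => ?_) i
    · rw [coe_desing_last, hxP, sub_self]
    · refine Fin.lastCases ?_ (fun i => ?_) i
      · rw [coe_desing_castSucc_last, hxD, sub_self]
      · rw [desing_castSucc_castSucc, coe_LL]; exact hxe i

/-- **The tail rows of the de-singularized system** are the double extension of the old tail rows.
[folklore] -/
theorem tailRows_desing (x : Fin (q + 3) → K) :
    (fun i j => jrow f (q + 3) (desing f e D P i) x (Fin.succ j)) =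
      extFamily (fun i j => jrow f (q + 1) (e i) (Fin.init (Fin.init x)) (Fin.succ j))
        (W₁ D x ∘ Fin.succ) (W₂ P x ∘ Fin.succ) := by
  funext i
  change jrow f (q + 3) (desing f e D P i) x ∘ Fin.succ = _
  refine Fin.lastCases ?_ (fun i => ?_) i
  · rw [jrow_desing_last, extFamily, ext1, Fin.snoc_last]
  · rw [extFamily, ext1, Fin.snoc_castSucc]
    refine Fin.lastCases ?_ (fun i => ?_) i
    · rw [jrow_desing_castSucc_last, snoc_zero_comp_succ, ext1, Fin.snoc_last]
    · rw [desing_castSucc_castSucc, jrow_LL, snoc_zero_comp_succ, snoc_zero_comp_succ, ext1,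
        Fin.snoc_castSucc]
      rfl

/-- **The full rows of the de-singularized system** (row of `LL eL` first) are the double extension
of the old full rows. [folklore] -/
theorem fullRows_desing (eL : termFnRing f (q + 1)) (x : Fin (q + 3) → K) :
    (Fin.cons (jrow f (q + 3) (LL f eL) x) fun i => jrow f (q + 3) (desing f e D P i) x) =
      extFamily (Fin.cons (jrow f (q + 1) eL (Fin.init (Fin.init x))) fun i =>
          jrow f (q + 1) (e i) (Fin.init (Fin.init x)))
        (W₁ D x) (W₂ P x) := by
  have h2 : (fun i => jrow f (q + 3) (desing f e D P i) x) =
      Fin.snoc (Fin.snoc (fun i => jrow f (q + 3) (LL f (e i)) x)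
        (jrow f (q + 3) (desing f e D P (Fin.castSucc (Fin.last q))) x))
        (jrow f (q + 3) (desing f e D P (Fin.last (q + 1))) x) := by
    funext i
    refine Fin.lastCases ?_ (fun i => ?_) i
    · rw [Fin.snoc_last]
    · rw [Fin.snoc_castSucc]
      refine Fin.lastCases ?_ (fun i => ?_) i
      · rw [Fin.snoc_last]
      · rw [Fin.snoc_castSucc, desing_castSucc_castSucc]
  rw [h2, Fin.cons_snoc_eq_snoc_cons, Fin.cons_snoc_eq_snoc_cons, extFamily, ext1, jrow_desing_last,
    jrow_desing_castSucc_last]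
  congr 1
  funext i
  refine Fin.lastCases ?_ (fun i => ?_) i
  · rw [Fin.snoc_last, ext1, Fin.snoc_last]
  · rw [Fin.snoc_castSucc, ext1, Fin.snoc_castSucc]
    refine Fin.cases ?_ (fun i => ?_) i
    · rw [Fin.cons_zero, Fin.cons_zero, jrow_LL]
    · rw [Fin.cons_succ, Fin.cons_succ, jrow_LL]

end DesingLemmas

/-! #### Determinants with entries in a stage of the chain -/

/-- The determinant of a matrix of derivatives, as an element of the stage containing them, and its
values. [folklore] -/
theorem coe_det_val {m : ℕ} {M : Subring (termFnRing f n)} (A : Matrix (Fin m) (Fin m) M) (x : Fin n → K) :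
    (((A.det : M) : termFnRing f n) : (Fin n → K) → K) x =
      (Matrix.of fun i j => (((A i j : M) : termFnRing f n) : (Fin n → K) → K) x).det := by
  have h1 : ((A.det : M) : termFnRing f n) = (M.subtype.mapMatrix A).det := by
    rw [← RingHom.map_det]; rfl
  rw [h1, ← evalAt_apply f n x, RingHom.map_det]
  rfl

/-- **Step B of the proof of Theorem 2** (Wilkie 1989, p. 405), in normalized prepared form: let
`e₁, …, e_q ∈ M = M_J` and `e_{q+1} = 1 + e^{g} R` with `R` of degree `≤ s`, let
`ᾱ ∈ Vⁿˢ(e₁, …, e_{q+1})` with `det ∂(e₁, …, e_q)/∂(x₂, …, x_{q+1})(ᾱ) ≠ 0`, and assume the inductive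
hypothesis `P_{j+1,s}` (for all numbers of variables).  Then `ᾱ ∈ k^{q+1}`: de-singularize
`D = det J` and `p(e^g) = e^{-g} (det J) g*` (two new variables), which puts the system in the
curve form of `stepC` in `q + 3` variables. [cite: Wilkie1989, §6, p. 405] -/
theorem stepB_core
    (hbd : ∀ (n : ℕ) (α : Fin n → K), IsExpAlgebraicPointOver f α → IsBoundedOver f α) (h s : ℕ)
    (hIH : ∀ (N : ℕ) (gg : ℕ → termFnRing f N), (∀ i, N ≤ i → gg i ∈ chain f N gg i) →
      IH f N gg (N + h) s)
    {g : ℕ → termFnRing f (q + 1)} (hg : ∀ i, q + 1 ≤ i → g i ∈ chain f (q + 1) g i)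
    (e : Fin q → termFnRing f (q + 1)) (he : ∀ i, e i ∈ chain f (q + 1) g (q + 1 + h))
    (R : termFnRing f (q + 1))
    (hR : DegLT (chain f (q + 1) g (q + 1 + h)) (chainGen f (q + 1) g (q + 1 + h)) R (s + 1))
    {α : Fin (q + 1) → K}
    (hα : α ∈ VnsF f (q + 1) (Fin.snoc e (1 + chainGen f (q + 1) g (q + 1 + h) * R)))
    (htail : (Matrix.of fun i j => jrow f (q + 1) (e i) α (Fin.succ j)).det ≠ 0) :
    α ∈ kPts f (q + 1) := by
  classical
  -- notation
  have hJ : q + 1 ≤ q + 1 + h := by omega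
  have hgJ : g (q + 1 + h) ∈ chain f (q + 1) g (q + 1 + h) := hg _ hJ
  have hYexp : chainGen f (q + 1) g (q + 1 + h) = expFn f (q + 1) (g (q + 1 + h)) :=
    chainGen_of_le f (q + 1) g hJ
  have hYne : ∀ x, ((chainGen f (q + 1) g (q + 1 + h) : termFnRing f (q + 1)) : (Fin (q + 1) → K) → K) x ≠ 0 :=
    fun x => by rw [hYexp]; exact expFn_apply_ne_zero f (q + 1) _ x
  have heα : ∀ i, ((e i : termFnRing f (q + 1)) : (Fin (q + 1) → K) → K) α = 0 := fun i => by
    have := hα.1 (Fin.castSucc i); simpa using this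
  have heLα : ((1 + chainGen f (q + 1) g (q + 1 + h) * R : termFnRing f (q + 1)) :
      (Fin (q + 1) → K) → K) α = 0 := by
    have := hα.1 (Fin.last q); simpa using this
  /- the tail determinant `D ∈ M_J` -/
  have hpdmem : ∀ i (l : Fin (q + 1)), pd f (q + 1) l (e i) ∈ chain f (q + 1) g (q + 1 + h) :=
    fun i l => pd_mem_chain f (q + 1) g hg (he i) l
  let Dm : Matrix (Fin q) (Fin q) (chain f (q + 1) g (q + 1 + h)) :=
    Matrix.of fun i j => ⟨pd f (q + 1) j.succ (e i), hpdmem i j.succ⟩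
  let D : termFnRing f (q + 1) := ((Dm.det : chain f (q + 1) g (q + 1 + h)) : termFnRing f (q + 1))
  have hDmem : D ∈ chain f (q + 1) g (q + 1 + h) := Dm.det.2
  have hDval : ∀ x, (D : (Fin (q + 1) → K) → K) x =
      (Matrix.of fun i j => jrow f (q + 1) (e i) x j.succ).det := fun x => coe_det_val Dm x
  have hDα : (D : (Fin (q + 1) → K) → K) α ≠ 0 := by rw [hDval]; exact htail
  /- the derivatives of `eL`: `∂eL/∂xₗ = Y · Rₗ` with `Rₗ` of degree `≤ s` -/
  let Rl : Fin (q + 1) → termFnRing f (q + 1) := fun l =>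
    pd f (q + 1) l (g (q + 1 + h)) * R + pd f (q + 1) l R
  have hpdL : ∀ l, pd f (q + 1) l (1 + chainGen f (q + 1) g (q + 1 + h) * R) =
      chainGen f (q + 1) g (q + 1 + h) * Rl l := by
    intro l
    rw [pd_add, pd_one, zero_add, pd_mul, hYexp, pd_expFn, mul_add, mul_assoc]
  have hRl_deg : ∀ l, DegLT (chain f (q + 1) g (q + 1 + h)) (chainGen f (q + 1) g (q + 1 + h)) (Rl l) (s + 1) :=
    fun l => (hR.mem_mul (pd_mem_chain f (q + 1) g hg hgJ l)).add (hR.pd' hg hJ l)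
  /- the full determinant `det ∂(eL, e₁, …, e_q)/∂(x̄) = Y · pY` with `pY` of degree `≤ s` -/
  let minorM : Fin (q + 1) → Matrix (Fin q) (Fin q) (chain f (q + 1) g (q + 1 + h)) := fun l =>
    Matrix.of fun i j => ⟨pd f (q + 1) (l.succAbove j) (e i), hpdmem i _⟩
  let minor : Fin (q + 1) → termFnRing f (q + 1) := fun l =>
    (((minorM l).det : chain f (q + 1) g (q + 1 + h)) : termFnRing f (q + 1))
  have hminor_mem : ∀ l, minor l ∈ chain f (q + 1) g (q + 1 + h) := fun l => (minorM l).det.2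
  have hminor_val : ∀ l x, (minor l : (Fin (q + 1) → K) → K) x =
      (Matrix.of fun i j => jrow f (q + 1) (e i) x (l.succAbove j)).det := fun l x => coe_det_val (minorM l) x
  let pY : termFnRing f (q + 1) := ∑ l : Fin (q + 1), ((-1) ^ (l : ℕ) * minor l) * Rl l
  have hsign_mem : ∀ l : Fin (q + 1), ((-1 : termFnRing f (q + 1)) ^ (l : ℕ)) ∈ chain f (q + 1) g (q + 1 + h) :=
    fun l => Subring.pow_mem _ (Subring.neg_mem _ (Subring.one_mem _)) _
  have hpY_deg : DegLT (chain f (q + 1) g (q + 1 + h)) (chainGen f (q + 1) g (q + 1 + h)) pY (s + 1) :=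
    DegLT.sum _ (Nat.succ_pos s) fun l _ =>
      (hRl_deg l).mem_mul (Subring.mul_mem _ (hsign_mem l) (hminor_mem l))
  have hpY_val : ∀ x, (pY : (Fin (q + 1) → K) → K) x =
      ∑ l : Fin (q + 1), ((-1) ^ (l : ℕ) * (Matrix.of fun i j => jrow f (q + 1) (e i) x (l.succAbove j)).det) *
        (Rl l : (Fin (q + 1) → K) → K) x := by
    intro x
    rw [← evalAt_apply f (q + 1) x, _root_.map_sum]
    refine Finset.sum_congr rfl fun l _ => ?_
    rw [_root_.map_mul, _root_.map_mul, _root_.map_pow, _root_.map_neg, _root_.map_one, evalAt_apply,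
      evalAt_apply, hminor_val]
  have hfull_val : ∀ x, (Matrix.of (Fin.cons (jrow f (q + 1) (1 + chainGen f (q + 1) g (q + 1 + h) * R) x)
      fun i => jrow f (q + 1) (e i) x)).det =
      ((chainGen f (q + 1) g (q + 1 + h) : termFnRing f (q + 1)) : (Fin (q + 1) → K) → K) x *
        (pY : (Fin (q + 1) → K) → K) x := by
    intro x
    rw [Matrix.det_succ_row_zero, hpY_val, Finset.mul_sum]
    refine Finset.sum_congr rfl fun l _ => ?_
    have hrow : (Matrix.of (Fin.cons (jrow f (q + 1) (1 + chainGen f (q + 1) g (q + 1 + h) * R) x)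
        fun i => jrow f (q + 1) (e i) x)) 0 l =
        ((chainGen f (q + 1) g (q + 1 + h) : termFnRing f (q + 1)) : (Fin (q + 1) → K) → K) x *
          (Rl l : (Fin (q + 1) → K) → K) x := by
      simp only [Matrix.of_apply, Fin.cons_zero, jrow, hpdL, Subring.coe_mul, Pi.mul_apply]
    have hsubm : (Matrix.of (Fin.cons (jrow f (q + 1) (1 + chainGen f (q + 1) g (q + 1 + h) * R) x)
        fun i => jrow f (q + 1) (e i) x)).submatrix Fin.succ l.succAbove =
        Matrix.of fun i j => jrow f (q + 1) (e i) x (l.succAbove j) := by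
      ext i j
      simp only [Matrix.submatrix_apply, Matrix.of_apply, Fin.cons_succ]
    rw [hrow, hsubm]
    ring
  /- at `α`: the full determinant does not vanish, hence `pY(α) ≠ 0` -/
  have hfullα : (Matrix.of (Fin.cons (jrow f (q + 1) (1 + chainGen f (q + 1) g (q + 1 + h) * R) α)
      fun i => jrow f (q + 1) (e i) α)).det ≠ 0 := by
    rw [← linearIndependent_rows_iff_det_ne_zero]
    have h2 := hα.2
    rw [jrow_snoc, linearIndependent_finSnoc] at h2
    exact linearIndependent_finCons.2 ⟨h2.1, h2.2⟩
  have hpYα : (pY : (Fin (q + 1) → K) → K) α ≠ 0 := by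
    intro h0; apply hfullα; rw [hfull_val, h0, mul_zero]
  /- B4: adjoin `x_{q+2} = 1/D` and `x_{q+3} = 1/pY`: the system `desing e D pY`, `gL = LL eL` -/
  have hg₁a : ∀ i, q + 2 ≤ i → liftExp f (q + 1) g i ∈ chain f (q + 2) (liftExp f (q + 1) g) i :=
    liftExp_admissible hg
  have hg₂a : ∀ i, q + 3 ≤ i → liftExp f (q + 2) (liftExp f (q + 1) g) i ∈
      chain f (q + 3) (liftExp f (q + 2) (liftExp f (q + 1) g)) i := liftExp_admissible hg₁a
  -- memberships and degrees at stage `J + 2`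
  have hLLmem : ∀ F, F ∈ chain f (q + 1) g (q + 1 + h) →
      LL f F ∈ chain f (q + 3) (liftExp f (q + 2) (liftExp f (q + 1) g)) (q + 1 + h + 2) :=
    fun F hF => liftFn_mem_chain_succ _ (liftFn_mem_chain_succ g hF)
  have hu₁mem : liftFn f (q + 2) (coordFn f (q + 2) (Fin.last (q + 1)) * liftFn f (q + 1) D - 1) ∈
      chain f (q + 3) (liftExp f (q + 2) (liftExp f (q + 1) g)) (q + 1 + h + 2) := by
    refine liftFn_mem_chain_succ _ (Subring.sub_mem _ (Subring.mul_mem _ ?_ (liftFn_mem_chain_succ g hDmem))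
      (Subring.one_mem _))
    exact coordFn_last_mem_chain g (by omega)
  have hLLpY : DegLT (chain f (q + 3) (liftExp f (q + 2) (liftExp f (q + 1) g)) (q + 1 + h + 2))
      (chainGen f (q + 3) (liftExp f (q + 2) (liftExp f (q + 1) g)) (q + 1 + h + 2)) (LL f pY) (s + 1) :=
    DegLT.liftFn (g := liftExp f (q + 1) g) (by omega) (DegLT.liftFn (g := g) hJ hpY_deg)
  have hu₂deg : DegLT (chain f (q + 3) (liftExp f (q + 2) (liftExp f (q + 1) g)) (q + 1 + h + 2))
      (chainGen f (q + 3) (liftExp f (q + 2) (liftExp f (q + 1) g)) (q + 1 + h + 2))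
      (coordFn f (q + 3) (Fin.last (q + 2)) * LL f pY - 1) (s + 1) :=
    (hLLpY.mem_mul (coordFn_last_mem_chain _ (by omega))).sub (degLT_one (Nat.succ_pos s))
  have hgc_deg : ∀ i, DegLT (chain f (q + 3) (liftExp f (q + 2) (liftExp f (q + 1) g)) (q + 1 + h + 2))
      (chainGen f (q + 3) (liftExp f (q + 2) (liftExp f (q + 1) g)) (q + 1 + h + 2))
      (desing f e D pY i) (s + 1) := by
    intro i
    refine Fin.lastCases ?_ (fun i => ?_) i
    · rw [desing_last]; exact hu₂deg
    · refine Fin.lastCases ?_ (fun i => ?_) i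
      · rw [desing_castSucc_last]; exact degLT_of_mem hu₁mem (Nat.succ_pos s)
      · rw [desing_castSucc_castSucc]; exact degLT_of_mem (hLLmem _ (he i)) (Nat.succ_pos s)
  /- the point `α̌ = (ᾱ, 1/D(ᾱ), 1/pY(ᾱ))` -/
  let αc : Fin (q + 3) → K := Fin.snoc (Fin.snoc α ((D : (Fin (q + 1) → K) → K) α)⁻¹)
    ((pY : (Fin (q + 1) → K) → K) α)⁻¹
  have hinit : Fin.init (Fin.init αc) = α := by
    simp only [αc, Fin.init_snoc]
  have hαc1 : αc (Fin.castSucc (Fin.last (q + 1))) = ((D : (Fin (q + 1) → K) → K) α)⁻¹ := by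
    simp only [αc, Fin.snoc_castSucc, Fin.snoc_last]
  have hαc2 : αc (Fin.last (q + 2)) = ((pY : (Fin (q + 1) → K) → K) α)⁻¹ := by
    simp only [αc, Fin.snoc_last]
  have hαcV : αc ∈ VF f (q + 3) (desing f e D pY) := by
    rw [mem_VF_desing_iff, hinit, hαc1, hαc2, inv_mul_cancel₀ hDα, inv_mul_cancel₀ hpYα]
    exact ⟨mem_VF.2 heα, rfl, rfl⟩
  have hαcL : ((LL f (1 + chainGen f (q + 1) g (q + 1 + h) * R) : termFnRing f (q + 3)) :
      (Fin (q + 3) → K) → K) αc = 0 := by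
    rw [coe_LL, hinit]; exact heLα
  /- the tail rows and the full rows are independent throughout `V(desing)` -/
  have htail' : ∀ x ∈ VF f (q + 3) (desing f e D pY),
      (Matrix.of fun i j => jrow f (q + 3) (desing f e D pY i) x (Fin.succ j)).det ≠ 0 := by
    intro x hx
    obtain ⟨hxe, hxD, hxP⟩ := (mem_VF_desing_iff e D pY x).1 hx
    have hD0 : (D : (Fin (q + 1) → K) → K) (Fin.init (Fin.init x)) ≠ 0 := fun h0 => by
      rw [h0, mul_zero] at hxD; exact zero_ne_one hxD
    have hP0 : (pY : (Fin (q + 1) → K) → K) (Fin.init (Fin.init x)) ≠ 0 := fun h0 => by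
      rw [h0, mul_zero] at hxP; exact zero_ne_one hxP
    have hτ : LinearIndependent K fun i j => jrow f (q + 1) (e i) (Fin.init (Fin.init x)) (Fin.succ j) := by
      have : (Matrix.of fun i j => jrow f (q + 1) (e i) (Fin.init (Fin.init x)) (Fin.succ j)).det ≠ 0 := by
        rw [← hDval]; exact hD0
      rwa [← linearIndependent_rows_iff_det_ne_zero] at this
    rw [← linearIndependent_rows_iff_det_ne_zero]
    show LinearIndependent K fun i j => jrow f (q + 3) (desing f e D pY i) x (Fin.succ j)
    rw [tailRows_desing]
    refine linearIndependent_extFamily hτ ?_ ?_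
    · rw [W₁_succ_last]; exact hD0
    · rw [W₂_succ_last]; exact hP0
  have hfull' : ∀ x ∈ VF f (q + 3) (desing f e D pY),
      (Matrix.of (Fin.cons (jrow f (q + 3) (LL f (1 + chainGen f (q + 1) g (q + 1 + h) * R)) x)
        fun i => jrow f (q + 3) (desing f e D pY i) x)).det ≠ 0 := by
    intro x hx
    obtain ⟨hxe, hxD, hxP⟩ := (mem_VF_desing_iff e D pY x).1 hx
    have hD0 : (D : (Fin (q + 1) → K) → K) (Fin.init (Fin.init x)) ≠ 0 := fun h0 => by
      rw [h0, mul_zero] at hxD; exact zero_ne_one hxD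
    have hP0 : (pY : (Fin (q + 1) → K) → K) (Fin.init (Fin.init x)) ≠ 0 := fun h0 => by
      rw [h0, mul_zero] at hxP; exact zero_ne_one hxP
    have hρ : LinearIndependent K (Fin.cons (jrow f (q + 1) (1 + chainGen f (q + 1) g (q + 1 + h) * R)
        (Fin.init (Fin.init x))) fun i => jrow f (q + 1) (e i) (Fin.init (Fin.init x))) := by
      have : (Matrix.of (Fin.cons (jrow f (q + 1) (1 + chainGen f (q + 1) g (q + 1 + h) * R)
          (Fin.init (Fin.init x))) fun i => jrow f (q + 1) (e i) (Fin.init (Fin.init x)))).det ≠ 0 := by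
        rw [hfull_val]; exact mul_ne_zero (hYne _) hP0
      rwa [← linearIndependent_rows_iff_det_ne_zero] at this
    rw [← linearIndependent_rows_iff_det_ne_zero]
    show LinearIndependent K (Fin.cons (jrow f (q + 3) (LL f (1 + chainGen f (q + 1) g (q + 1 + h) * R)) x)
      fun i => jrow f (q + 3) (desing f e D pY i) x)
    rw [fullRows_desing]
    refine linearIndependent_extFamily hρ ?_ ?_
    · rw [W₁_last]; exact hD0
    · rw [W₂_last]; exact hP0
  /- Step C -/
  have hIH2 : IH f (q + 2 + 1) (liftExp f (q + 2) (liftExp f (q + 1) g)) (q + 1 + h + 2) s := by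
    have := hIH (q + 3) _ hg₂a
    rwa [show q + 3 + h = q + 1 + h + 2 by omega] at this
  obtain ⟨β, hβ⟩ := stepC' (m := q + 2) hbd hg₂a (by omega) hIH2 (desing f e D pY) hgc_deg
    (LL f (1 + chainGen f (q + 1) g (q + 1 + h) * R)) htail' hfull' hαcV hαcL
  refine ⟨fun i => β (Fin.castSucc (Fin.castSucc i)), funext fun i => ?_⟩
  have := congrFun hβ (Fin.castSucc (Fin.castSucc i))
  rw [← hinit]
  exact this

end StepB

/-! #### Step B with the permutation of variables -/

section StepBPerm

variable {q : ℕ}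

/-- **Step B of the proof of Theorem 2** (p. 405), prepared form: `e₁, …, e_q ∈ M_J`,
`e_{q+1} = 1 + e^{g} R` with `R` of degree `≤ s`, `ᾱ ∈ Vⁿˢ(e₁, …, e_{q+1})`, and the inductive
hypothesis `P_{j+1,s}` for all numbers of variables; then `ᾱ ∈ k^{q+1}`.  "Now since
`(dg₁ ∧ ⋯ ∧ dgₙ₋₁)(ᾱ) ≠ 0` we may suppose (by permuting variables if necessary) that `(det J)(ᾱ) ≠ 0`"
— then `stepB_core`. [cite: Wilkie1989, §6, p. 405] -/
theorem stepB
    (hbd : ∀ (n : ℕ) (α : Fin n → K), IsExpAlgebraicPointOver f α → IsBoundedOver f α) (h s : ℕ)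
    (hIH : ∀ (N : ℕ) (gg : ℕ → termFnRing f N), (∀ i, N ≤ i → gg i ∈ chain f N gg i) →
      IH f N gg (N + h) s)
    {g : ℕ → termFnRing f (q + 1)} (hg : ∀ i, q + 1 ≤ i → g i ∈ chain f (q + 1) g i)
    (e : Fin q → termFnRing f (q + 1)) (he : ∀ i, e i ∈ chain f (q + 1) g (q + 1 + h))
    (R : termFnRing f (q + 1))
    (hR : DegLT (chain f (q + 1) g (q + 1 + h)) (chainGen f (q + 1) g (q + 1 + h)) R (s + 1))
    {α : Fin (q + 1) → K}
    (hα : α ∈ VnsF f (q + 1) (Fin.snoc e (1 + chainGen f (q + 1) g (q + 1 + h) * R))) :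
    α ∈ kPts f (q + 1) := by
  classical
  have hJ : q + 1 ≤ q + 1 + h := by omega
  -- the choice of the abscissa
  have hind : LinearIndependent K fun i => jrow f (q + 1) (e i) α := by
    have h2 := hα.2
    rw [jrow_snoc, linearIndependent_finSnoc] at h2
    exact h2.1
  obtain ⟨l₀, hl₀⟩ := exists_swap_minor_ne_zero (Matrix.of fun i => jrow f (q + 1) (e i) α) hind
  set σ : Equiv.Perm (Fin (q + 1)) := Equiv.swap l₀ 0 with hσ
  -- the permuted data
  have hgσ := permExp_admissible σ hg
  have heσ : ∀ i, permFn f (q + 1) σ (e i) ∈ chain f (q + 1) (permExp f (q + 1) σ g) (q + 1 + h) :=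
    fun i => permFn_mem_chain σ g hJ (he i)
  have hRσ := DegLT.permFn σ hJ hR
  have hsys : (fun r => permFn f (q + 1) σ ((Fin.snoc e (1 + chainGen f (q + 1) g (q + 1 + h) * R) :
      Fin (q + 1) → termFnRing f (q + 1)) r)) =
      Fin.snoc (fun i => permFn f (q + 1) σ (e i))
        (1 + chainGen f (q + 1) (permExp f (q + 1) σ g) (q + 1 + h) * permFn f (q + 1) σ R) := by
    have : (fun r => permFn f (q + 1) σ ((Fin.snoc e (1 + chainGen f (q + 1) g (q + 1 + h) * R) :
        Fin (q + 1) → termFnRing f (q + 1)) r)) =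
        (permFn f (q + 1) σ) ∘ Fin.snoc e (1 + chainGen f (q + 1) g (q + 1 + h) * R) := rfl
    rw [this, Fin.comp_snoc, _root_.map_add, _root_.map_one, _root_.map_mul, permFn_chainGen_of_le σ g hJ]
    rfl
  have hασ : α ∘ σ.symm ∈ VnsF f (q + 1) (Fin.snoc (fun i => permFn f (q + 1) σ (e i))
      (1 + chainGen f (q + 1) (permExp f (q + 1) σ g) (q + 1 + h) * permFn f (q + 1) σ R)) := by
    rw [← hsys, mem_VnsF_comp_permFn]
    have : (α ∘ σ.symm) ∘ σ = α := by funext i; simp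
    rw [this]; exact hα
  have htailσ : (Matrix.of fun i j => jrow f (q + 1) (permFn f (q + 1) σ (e i)) (α ∘ σ.symm) (Fin.succ j)).det ≠ 0 := by
    have hA : (Matrix.of fun i j => jrow f (q + 1) (permFn f (q + 1) σ (e i)) (α ∘ σ.symm) (Fin.succ j)) =
        (Matrix.of fun i => jrow f (q + 1) (e i) α).submatrix _root_.id fun j : Fin q => Equiv.swap l₀ 0 j.succ := by
      ext i j
      have hcomp : ((α ∘ (Equiv.swap l₀ 0)) ∘ (Equiv.swap l₀ 0) : Fin (q + 1) → K) = α := by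
        funext i; simp
      simp only [Matrix.of_apply, Matrix.submatrix_apply, id_eq, jrow_permFn, Function.comp_apply, hσ,
        Equiv.symm_swap, hcomp]
    rw [hA]; exact hl₀
  obtain ⟨β, hβ⟩ := stepB_core hbd h s hIH hgσ (fun i => permFn f (q + 1) σ (e i)) heσ (permFn f (q + 1) σ R)
    hRσ hασ htailσ
  exact (exists_comp_eq_comp_perm_iff σ.symm α).1 ⟨β, hβ⟩

end StepBPerm

/-! ### Step A and the inductive step `P_{j+1,s} ⇒ P_{j+1,s+1}` (pp. 403–405) -/

section MainStep

/-- Membership in a span of padded vectors with one extra vector of non-zero last coordinate: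
the coefficient of the extra vector vanishes. [folklore] -/
theorem mem_span_of_snoc_zero_mem_span {p N : ℕ} {v : Fin p → Fin N → K} {u : Fin (N + 1) → K}
    (hu : u (Fin.last N) ≠ 0) {w : Fin N → K}
    (hw : (Fin.snoc w 0 : Fin (N + 1) → K) ∈ Submodule.span K
      (Set.range (Fin.snoc (fun i => (Fin.snoc (v i) 0 : Fin (N + 1) → K)) u))) :
    w ∈ Submodule.span K (Set.range v) := by
  classical
  rw [Submodule.mem_span_range_iff_exists_fun] at hw ⊢
  obtain ⟨c, hc⟩ := hw
  rw [Fin.sum_univ_castSucc] at hc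
  simp only [Fin.snoc_castSucc, Fin.snoc_last] at hc
  -- last coordinate: `c last * u last = 0`
  have hlast := congrFun hc (Fin.last N)
  simp only [Pi.add_apply, Finset.sum_apply, Pi.smul_apply, Fin.snoc_last, smul_eq_mul, mul_zero,
    Finset.sum_const_zero, zero_add] at hlast
  have hc0 : c (Fin.last p) = 0 := by
    rcases mul_eq_zero.1 hlast with h0 | h0
    · exact h0
    · exact (hu h0).elim
  rw [hc0, zero_smul, add_zero] at hc
  refine ⟨fun i => c (Fin.castSucc i), funext fun j => ?_⟩
  have := congrFun hc (Fin.castSucc j)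
  simpa [Finset.sum_apply, Fin.snoc_castSucc] using this

/-- **The inductive step `P_{j+1,s} ⇒ P_{j+1,s+1}`** of the proof of Theorem 2 (Wilkie 1989,
pp. 403–407): Lemma 2 at `ᾱ` (only the case `p = n - 1`, `hₙ` of degree exactly `s + 1` survives
the inductive hypothesis); write `hₙ = Σᵢ₌₀^{s+1} aᵢ e^{ig}`.  If `a₀(ᾱ) = 0`, the inductive
hypothesis applies to `(h̄, a₀)` or to `(h̄, e^{-g}(hₙ - a₀))`.  If `a₀(ᾱ) ≠ 0`, adjoin
`x_{n+1} = a₀(ᾱ)⁻¹` with `u = x_{n+1} a₀ - 1` and `f = 1 + x_{n+1}(hₙ - a₀)`: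
`(ᾱ, a₀(ᾱ)⁻¹) ∈ Vⁿˢ(h̃₁, …, h̃ₙ₋₁, u, f)` is in prepared form, and Step B (then Step C) applies.
[cite: Wilkie1989, §6, pp. 403–405] -/
theorem mainStep
    (hbd : ∀ (n : ℕ) (α : Fin n → K), IsExpAlgebraicPointOver f α → IsBoundedOver f α) (h s : ℕ)
    (hIH : ∀ (N : ℕ) (gg : ℕ → termFnRing f N), (∀ i, N ≤ i → gg i ∈ chain f N gg i) →
      IH f N gg (N + h) s)
    (N : ℕ) (g : ℕ → termFnRing f N) (hg : ∀ i, N ≤ i → g i ∈ chain f N g i) : IH f N g (N + h) (s + 1) := by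
  classical
  intro G hG α hα
  -- no variables: nothing to prove
  rcases Nat.eq_zero_or_pos N with hN0 | hNpos
  · subst hN0; exact ⟨Fin.elim0, funext fun i => i.elim0⟩
  obtain ⟨n, rfl⟩ : ∃ n, N = n + 1 := ⟨N - 1, by omega⟩
  have hJ : n + 1 ≤ n + 1 + h := by omega
  have hGmem : ∀ r, G r ∈ chain f (n + 1) g (n + 1 + h + 1) := fun r => (hG r).mem_chain_succ
  have hGα : ∀ r, ((G r : termFnRing f (n + 1)) : (Fin (n + 1) → K) → K) α = 0 := hα.1
  -- Lemma 2 at `ᾱ`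
  obtain ⟨p, F, hpN, hF, hαF, hcases⟩ := lemma2_cases hg (n + 1 + h) α
  rcases hcases with hpeq | ⟨hplt, h3⟩ | ⟨hplt, Gn, P, s₀, hmb, hαFG, h3⟩
  · -- (a) `p = n + 1`: the inductive hypothesis applies to `h̄`
    subst hpeq
    exact hIH (n + 1) g hg F (fun r => degLT_of_mem (hF r) (Nat.succ_pos s)) hαF
  · -- (b) clause (3): impossible since `ᾱ ∈ Vⁿˢ(G)` with `n + 1 > p` functions
    exfalso
    have := card_le_of_clause3 hαF h3 hGmem hα
    omega
  · by_cases hp1 : p + 1 < n + 1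
    · exfalso
      have := card_le_of_clause3 hαFG h3 hGmem hα
      omega
    · obtain rfl : n = p := by omega
      -- the degree of `hₙ` is at most `s + 1`
      have hs₀ : s₀ < s + 1 + 1 := hmb.lt_of_vnsF hG hα
      by_cases hs₀le : s₀ ≤ s
      · -- `hₙ` of degree `≤ s`: the inductive hypothesis applies to `(h̄, hₙ)`
        refine hIH (n + 1) g hg (Fin.snoc F Gn) (fun r => ?_) hαFG
        refine Fin.lastCases ?_ (fun r => ?_) r
        · rw [Fin.snoc_last]; exact ⟨P, by rw [hmb.hPs]; omega, hmb.hPG⟩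
        · rw [Fin.snoc_castSucc]; exact degLT_of_mem (hF r) (Nat.succ_pos s)
      · have hs₀eq : s₀ = s + 1 := by omega
        -- `hₙ = a₀ + Y h'` with `h' = Σᵢ₌₁ aᵢ Yⁱ⁻¹` of degree `≤ s`
        set Y := chainGen f (n + 1) g (n + 1 + h) with hYdef
        have hYexp : Y = expFn f (n + 1) (g (n + 1 + h)) := by rw [hYdef, chainGen_of_le f (n + 1) g hJ]
        have hYne : ∀ x, (Y : (Fin (n + 1) → K) → K) x ≠ 0 := fun x => by
          rw [hYexp]; exact expFn_apply_ne_zero f (n + 1) _ x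
        set a₀ : termFnRing f (n + 1) := ((P.coeff 0 : chain f (n + 1) g (n + 1 + h)) : termFnRing f (n + 1))
          with ha₀def
        have ha₀mem : a₀ ∈ chain f (n + 1) g (n + 1 + h) := (P.coeff 0).2
        set h' : termFnRing f (n + 1) :=
          ((P.divX).map (chain f (n + 1) g (n + 1 + h)).subtype).eval Y with hh'def
        have hh'deg : DegLT (chain f (n + 1) g (n + 1 + h)) Y h' (s + 1) :=
          degLT_eval (by rw [Polynomial.natDegree_divX_eq_natDegree_tsub_one, hmb.hPs]; omega)
        have hGn : Gn = h' * Y + a₀ := by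
          rw [← hmb.hPG]
          conv_lhs => rw [← Polynomial.divX_mul_X_add P]
          rw [Polynomial.map_add, Polynomial.map_mul, Polynomial.map_X, Polynomial.map_C, eval_add, eval_mul,
            eval_X, eval_C]
          rfl
        have hGnα : ((Gn : termFnRing f (n + 1)) : (Fin (n + 1) → K) → K) α = 0 := by
          have := hαFG.1 (Fin.last n); simpa using this
        have hFα : ∀ r, ((F r : termFnRing f (n + 1)) : (Fin (n + 1) → K) → K) α = 0 := hαF.1
        have hFind : LinearIndependent K fun r => jrow f (n + 1) (F r) α := hαF.2
        have hsnoc := hαFG.2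
        rw [jrow_snoc, linearIndependent_finSnoc] at hsnoc
        -- the value relation `h'(α) Y(α) + a₀(α) = 0`
        have hval : (h' : (Fin (n + 1) → K) → K) α * (Y : (Fin (n + 1) → K) → K) α +
            (a₀ : (Fin (n + 1) → K) → K) α = 0 := by
          have := hGnα
          rw [hGn] at this
          simpa using this
        by_cases ha₀ : (a₀ : (Fin (n + 1) → K) → K) α = 0
        · -- `a₀(ᾱ) = 0`, hence `h'(ᾱ) = 0`
          have hh'α : (h' : (Fin (n + 1) → K) → K) α = 0 := by
            rw [ha₀, add_zero] at hval
            rcases mul_eq_zero.1 hval with h0 | h0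
            · exact h0
            · exact (hYne α h0).elim
          by_cases hind : LinearIndependent K fun r => jrow f (n + 1) ((Fin.snoc F a₀ : Fin (n + 1) → termFnRing f (n + 1)) r) α
          · -- `ᾱ ∈ Vⁿˢ(h̄, a₀)`, all in `M`: the inductive hypothesis (`P_{j+1,0}`)
            refine hIH (n + 1) g hg (Fin.snoc F a₀) (fun r => ?_) ⟨?_, hind⟩
            · refine Fin.lastCases ?_ (fun r => ?_) r
              · rw [Fin.snoc_last]; exact degLT_of_mem ha₀mem (Nat.succ_pos s)
              · rw [Fin.snoc_castSucc]; exact degLT_of_mem (hF r) (Nat.succ_pos s)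
            · rw [mem_VF]; intro r
              refine Fin.lastCases ?_ (fun r => ?_) r
              · rw [Fin.snoc_last]; exact ha₀
              · rw [Fin.snoc_castSucc]; exact hFα r
          · -- `∇a₀(ᾱ) ∈ span ∇h̄(ᾱ)`: then `ᾱ ∈ Vⁿˢ(h̄, h')`, `h'` of degree `≤ s`
            have ha₀span : jrow f (n + 1) a₀ α ∈ Submodule.span K (Set.range fun r => jrow f (n + 1) (F r) α) := by
              rw [jrow_snoc, linearIndependent_finSnoc, not_and] at hind
              by_contra hno
              exact hind hFind hno
            have hGnrow : jrow f (n + 1) Gn α = jrow f (n + 1) a₀ α + ((Y : (Fin (n + 1) → K) → K) α) • jrow f (n + 1) h' α := by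
              rw [hGn, jrow_add', jrow_mul', hh'α, zero_smul, add_zero]
              exact add_comm _ _
            refine hIH (n + 1) g hg (Fin.snoc F h') (fun r => ?_) ⟨?_, ?_⟩
            · refine Fin.lastCases ?_ (fun r => ?_) r
              · rw [Fin.snoc_last]; exact hh'deg
              · rw [Fin.snoc_castSucc]; exact degLT_of_mem (hF r) (Nat.succ_pos s)
            · rw [mem_VF]; intro r
              refine Fin.lastCases ?_ (fun r => ?_) r
              · rw [Fin.snoc_last]; exact hh'α
              · rw [Fin.snoc_castSucc]; exact hFα r
            · rw [jrow_snoc, linearIndependent_finSnoc]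
              refine ⟨hFind, fun hmem => hsnoc.2 ?_⟩
              rw [hGnrow]
              exact Submodule.add_mem _ ha₀span (Submodule.smul_mem _ _ hmem)
        · /- `a₀(ᾱ) ≠ 0`: Step A — adjoin `x_{n+2} = a₀(ᾱ)⁻¹` (prepared form in `n + 2` variables),
             then Step B -/
          set L := liftFn f (n + 1) with hL
          set g' := liftExp f (n + 1) g with hg'
          have hg'a : ∀ i, n + 2 ≤ i → g' i ∈ chain f (n + 2) g' i := liftExp_admissible hg
          set xl : termFnRing f (n + 2) := coordFn f (n + 2) (Fin.last (n + 1)) with hxl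
          have hxlmem : xl ∈ chain f (n + 2) g' (n + 2 + h) := coordFn_last_mem_chain g (by omega)
          set u : termFnRing f (n + 2) := xl * L a₀ - 1 with hu
          set e : Fin (n + 1) → termFnRing f (n + 2) := Fin.snoc (fun r => L (F r)) u with he
          have hemem : ∀ i, e i ∈ chain f (n + 2) g' (n + 2 + h) := by
            intro i
            refine Fin.lastCases ?_ (fun i => ?_) i
            · rw [he, Fin.snoc_last, hu]
              refine Subring.sub_mem _ (Subring.mul_mem _ hxlmem ?_) (Subring.one_mem _)
              have := liftFn_mem_chain_succ g ha₀mem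
              rwa [show n + 1 + h + 1 = n + 2 + h by omega] at this
            · rw [he, Fin.snoc_castSucc]
              have := liftFn_mem_chain_succ g (hF i)
              rwa [show n + 1 + h + 1 = n + 2 + h by omega] at this
          set R' : termFnRing f (n + 2) := xl * L h' with hR'
          have hY' : chainGen f (n + 2) g' (n + 2 + h) = L Y := by
            rw [hYdef, hL, liftFn_chainGen_of_le g hJ, show n + 1 + h + 1 = n + 2 + h by omega]
          have hR'deg : DegLT (chain f (n + 2) g' (n + 2 + h)) (chainGen f (n + 2) g' (n + 2 + h)) R' (s + 1) := by
            have h1 := DegLT.liftFn (g := g) hJ hh'deg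
            rw [show n + 1 + h + 1 = n + 2 + h by omega] at h1
            exact h1.mem_mul hxlmem
          -- the point `(ᾱ, a₀(ᾱ)⁻¹)`
          set α' : Fin (n + 2) → K := Fin.snoc α ((a₀ : (Fin (n + 1) → K) → K) α)⁻¹ with hα'
          have hinit : Fin.init α' = α := by rw [hα', Fin.init_snoc]
          have hlast : α' (Fin.last (n + 1)) = ((a₀ : (Fin (n + 1) → K) → K) α)⁻¹ := by rw [hα', Fin.snoc_last]
          -- values at `α'`
          have hLval : ∀ Fn : termFnRing f (n + 1), ((L Fn : termFnRing f (n + 2)) : (Fin (n + 2) → K) → K) α' =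
              (Fn : (Fin (n + 1) → K) → K) α := fun Fn => by rw [hL, coe_liftFn, hinit]
          have huval : ((u : termFnRing f (n + 2)) : (Fin (n + 2) → K) → K) α' = 0 := by
            rw [hu]
            simp only [AddSubgroupClass.coe_sub, Subring.coe_mul, Pi.sub_apply, Pi.mul_apply, OneMemClass.coe_one,
              Pi.one_apply, hLval, hxl, coe_coordFn, hlast, inv_mul_cancel₀ ha₀, sub_self]
          have hR'val : ((R' : termFnRing f (n + 2)) : (Fin (n + 2) → K) → K) α' =
              ((a₀ : (Fin (n + 1) → K) → K) α)⁻¹ * (h' : (Fin (n + 1) → K) → K) α := by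
            rw [hR']
            simp only [Subring.coe_mul, Pi.mul_apply, hLval, hxl, coe_coordFn, hlast]
          have heLval : ((1 + chainGen f (n + 2) g' (n + 2 + h) * R' : termFnRing f (n + 2)) :
              (Fin (n + 2) → K) → K) α' = 0 := by
            rw [hY']
            simp only [AddMemClass.coe_add, OneMemClass.coe_one, Subring.coe_mul, Pi.add_apply, Pi.one_apply,
              Pi.mul_apply, hLval, hR'val]
            have ha := ha₀
            field_simp
            linear_combination hval
          -- gradient rows at `α'`, as `snoc` vectors
          have hLrow : ∀ Fn : termFnRing f (n + 1), jrow f (n + 2) (L Fn) α' = Fin.snoc (jrow f (n + 1) Fn α) 0 :=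
            fun Fn => by rw [hL, jrow_liftFn, hinit]
          have hcsl : ∀ j : Fin (n + 1), (Fin.castSucc j : Fin (n + 2)) ≠ Fin.last (n + 1) :=
            fun j => (Fin.castSucc_lt_last j).ne
          have hurow : jrow f (n + 2) u α' =
              Fin.snoc (((a₀ : (Fin (n + 1) → K) → K) α)⁻¹ • jrow f (n + 1) a₀ α) ((a₀ : (Fin (n + 1) → K) → K) α) := by
            rw [hu, jrow_sub', jrow_one', sub_zero, jrow_mul', hLval, hLrow, hxl, jrow_coordFn', coe_coordFn, hlast]
            funext j
            refine Fin.lastCases ?_ (fun j => ?_) j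
            · simp
            · simp [hcsl j]
          have hYh : (Y : (Fin (n + 1) → K) → K) α * (h' : (Fin (n + 1) → K) → K) α =
              -(a₀ : (Fin (n + 1) → K) → K) α := by linear_combination hval
          have heLrow : jrow f (n + 2) (1 + chainGen f (n + 2) g' (n + 2 + h) * R') α' =
              Fin.snoc (((a₀ : (Fin (n + 1) → K) → K) α)⁻¹ • jrow f (n + 1) (h' * Y) α)
                (-(a₀ : (Fin (n + 1) → K) → K) α) := by
            rw [jrow_add', jrow_one', zero_add, hY', jrow_mul', hLval, hLrow, hR'val, hR', jrow_mul', hLval, hLrow,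
              hxl, jrow_coordFn', coe_coordFn, hlast, jrow_mul']
            funext j
            refine Fin.lastCases ?_ (fun j => ?_) j
            · simp [hYh]
            · simp only [Pi.add_apply, Pi.smul_apply, Fin.snoc_castSucc, smul_eq_mul, Pi.single_apply,
                hcsl j, if_false, mul_zero, zero_add]
              ring
          have hsumrow : jrow f (n + 2) u α' + jrow f (n + 2) (1 + chainGen f (n + 2) g' (n + 2 + h) * R') α' =
              ((a₀ : (Fin (n + 1) → K) → K) α)⁻¹ • (Fin.snoc (jrow f (n + 1) Gn α) 0 : Fin (n + 2) → K) := by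
            rw [hurow, heLrow, hGn, jrow_add']
            funext j
            refine Fin.lastCases ?_ (fun j => ?_) j
            · simp
            · simp only [Pi.add_apply, Pi.smul_apply, Fin.snoc_castSucc, smul_eq_mul]
              ring
          -- `α' ∈ Vⁿˢ(e, eL)`
          have hα'V : α' ∈ VnsF f (n + 2) (Fin.snoc e (1 + chainGen f (n + 2) g' (n + 2 + h) * R')) := by
            refine ⟨?_, ?_⟩
            · rw [mem_VF]; intro r
              refine Fin.lastCases ?_ (fun r => ?_) r
              · rw [Fin.snoc_last]; exact heLval
              · rw [Fin.snoc_castSucc, he]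
                refine Fin.lastCases ?_ (fun r => ?_) r
                · rw [Fin.snoc_last]; exact huval
                · rw [Fin.snoc_castSucc, hLval]; exact hFα r
            · rw [jrow_snoc, he, jrow_snoc]
              simp only [hLrow]
              rw [linearIndependent_finSnoc]
              have hulast : jrow f (n + 2) u α' (Fin.last (n + 1)) ≠ 0 := by
                rw [hurow, Fin.snoc_last]; exact ha₀
              have h1 : LinearIndependent K (Fin.snoc (fun r => (Fin.snoc (jrow f (n + 1) (F r) α) 0 : Fin (n + 2) → K))
                  (jrow f (n + 2) u α')) :=
                linearIndependent_snoc_of_last (linearIndependent_snoc_zero hFind) (fun i => by simp) hulast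
              refine ⟨h1, fun hmem => hsnoc.2 ?_⟩
              have hu_mem : jrow f (n + 2) u α' ∈ Submodule.span K (Set.range (Fin.snoc
                  (fun r => (Fin.snoc (jrow f (n + 1) (F r) α) 0 : Fin (n + 2) → K)) (jrow f (n + 2) u α'))) :=
                Submodule.subset_span ⟨Fin.last n, by rw [Fin.snoc_last]⟩
              have hsum := Submodule.add_mem _ hu_mem hmem
              rw [hsumrow] at hsum
              have hGnmem : (Fin.snoc (jrow f (n + 1) Gn α) 0 : Fin (n + 2) → K) ∈ Submodule.span K (Set.range (Fin.snoc
                  (fun r => (Fin.snoc (jrow f (n + 1) (F r) α) 0 : Fin (n + 2) → K)) (jrow f (n + 2) u α'))) := by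
                have := Submodule.smul_mem _ ((a₀ : (Fin (n + 1) → K) → K) α) hsum
                rwa [smul_smul, mul_inv_cancel₀ ha₀, one_smul] at this
              exact mem_span_of_snoc_zero_mem_span hulast hGnmem
          -- Step B
          have hmem := stepB (q := n + 1) hbd h s hIH hg'a e hemem R' hR'deg hα'V
          obtain ⟨β, hβ⟩ := hmem
          refine ⟨fun i => β (Fin.castSucc i), funext fun i => ?_⟩
          have := congrFun hβ (Fin.castSucc i)
          rw [← hinit]
          exact this

end MainStep

/-! ### The induction on `(j, s)` and the theorem -/

section Induction

/-- **All stages**: for every height `h`, every system from `M_{n+h}` has all its non-singular zeros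
`k`-rational ("We shall prove the following by induction on `⟨j, s⟩ ∈ ℕ²` (ordered
lexicographically) … `P_{j,s}`", Wilkie 1989, p. 403; `P_{0,s}` is the polynomial case,
`P_{j+1,0}` follows from `∀ s, P_{j,s}`, and `P_{j+1,s} ⇒ P_{j+1,s+1}` is `mainStep`).
[cite: Wilkie1989, §6, p. 403] -/
theorem allStages
    (hbd : ∀ (n : ℕ) (α : Fin n → K), IsExpAlgebraicPointOver f α → IsBoundedOver f α) :
    ∀ (h N : ℕ) (g : ℕ → termFnRing f N), (∀ i, N ≤ i → g i ∈ chain f N g i) →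
      ∀ (G : Fin N → termFnRing f N), (∀ r, G r ∈ chain f N g (N + h)) → VnsF f N G ⊆ kPts f N := by
  intro h
  induction h with
  | zero =>
    intro N g hg G hG α hα
    -- the polynomial case `P_{0,s}`
    have ht : ∀ r, fnOf f N (reprTerm f N (G r)) = G r := fun r => Subtype.ext (termFn_reprTerm f N (G r))
    have hfin : (VnsF f N G).Finite := by
      rw [VnsF_eq_nonsingularZeroSet ht]
      exact finite_nonsingularZeroSet' _ K _
    exact exists_eq_of_vnsF_chain_le le_rfl hG hα hfin
  | succ h ih =>
    -- `P_{h+1,s}` for all `s`, by induction on `s`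
    have hP : ∀ s (N : ℕ) (g : ℕ → termFnRing f N), (∀ i, N ≤ i → g i ∈ chain f N g i) → IH f N g (N + h) s := by
      intro s
      induction s with
      | zero =>
        intro N g hg G hG α hα
        refine ih N g hg G (fun r => ?_) hα
        obtain ⟨P, hP, hPG⟩ := hG r
        have hP0 : P.natDegree = 0 := by omega
        rw [Polynomial.eq_C_of_natDegree_eq_zero hP0, Polynomial.map_C, eval_C] at hPG
        rw [← hPG]
        exact (P.coeff 0).2
      | succ s ihs => exact mainStep hbd h s ihs
    intro N g hg G hG α hα
    classical
    -- a common degree bound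
    have hpoly : ∀ r, ∃ Q : Polynomial (chain f N g (N + h)),
        (Q.map (chain f N g (N + h)).subtype).eval (chainGen f N g (N + h)) = G r := fun r =>
      (mem_chain_succ f N g).1 (by have := hG r; rwa [show N + (h + 1) = N + h + 1 by omega] at this)
    choose Q hQ using hpoly
    set s := Finset.univ.sup fun r => (Q r).natDegree with hs
    refine hP s N g hg G (fun r => ⟨Q r, ?_, hQ r⟩) hα
    have : (Q r).natDegree ≤ s := Finset.le_sup (f := fun r => (Q r).natDegree) (Finset.mem_univ r)
    omega

end Induction


/-! ### Every finite system of terms lies in a finitely generated admissible chain -/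

section FiniteChain

variable (f n)

/-- The exponents occurring in a term, innermost first: for each subterm `exp(t')`, the function of
`t'` (so that adjoining `e^{g}` along the list builds all subterm functions). [folklore] -/
def expList : Language.orderedExpRing.Term (k ⊕ Fin n) → List (termFnRing f n)
  | var _ => []
  | func expRingFunc.add ts => (fun l => expList (ts l)) 0 ++ (fun l => expList (ts l)) 1
  | func expRingFunc.mul ts => (fun l => expList (ts l)) 0 ++ (fun l => expList (ts l)) 1
  | func expRingFunc.neg ts => (fun l => expList (ts l)) 0
  | func expRingFunc.zero _ => []
  | func expRingFunc.one _ => []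
  | func expRingFunc.exp ts => (fun l => expList (ts l)) 0 ++ [fnOf f n (ts 0)]

/-- The exponent sequence of a chain adjoining the given list after the polynomial stages.
[folklore] -/
def gOfList (L : List (termFnRing f n)) : ℕ → termFnRing f n := fun i => L.getD (i - n) 0

variable {f n}

/-- A sum term in constructor form. [folklore] -/
theorem func_add_eq (ts : Fin 2 → Language.orderedExpRing.Term (k ⊕ Fin n)) :
    func (expRingFunc.add : Language.orderedExpRing.Functions 2) ts = ts 0 + ts 1 := by
  show func _ ts = func _ ![ts 0, ts 1]
  congr 1; funext i; fin_cases i <;> rfl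

/-- A product term in constructor form. [folklore] -/
theorem func_mul_eq (ts : Fin 2 → Language.orderedExpRing.Term (k ⊕ Fin n)) :
    func (expRingFunc.mul : Language.orderedExpRing.Functions 2) ts = ts 0 * ts 1 := by
  show func _ ts = func _ ![ts 0, ts 1]
  congr 1; funext i; fin_cases i <;> rfl

/-- A negation term in constructor form. [folklore] -/
theorem func_neg_eq (ts : Fin 1 → Language.orderedExpRing.Term (k ⊕ Fin n)) :
    func (expRingFunc.neg : Language.orderedExpRing.Functions 1) ts = -ts 0 := by
  show func _ ts = func _ ![ts 0]
  congr 1; funext i; fin_cases i; rfl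

/-- An exponential term in constructor form. [folklore] -/
theorem func_exp_eq (ts : Fin 1 → Language.orderedExpRing.Term (k ⊕ Fin n)) :
    func (expRingFunc.exp : Language.orderedExpRing.Functions 1) ts = Language.orderedExpRing.termExp (ts 0) := by
  show func _ ts = func _ ![ts 0]
  congr 1; funext i; fin_cases i; rfl

/-- The zero term in constructor form. [folklore] -/
theorem func_zero_eq (ts : Fin 0 → Language.orderedExpRing.Term (k ⊕ Fin n)) :
    func (expRingFunc.zero : Language.orderedExpRing.Functions 0) ts = 0 := by
  show func _ ts = func _ _
  congr 1; funext i; exact i.elim0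

/-- The one term in constructor form. [folklore] -/
theorem func_one_eq (ts : Fin 0 → Language.orderedExpRing.Term (k ⊕ Fin n)) :
    func (expRingFunc.one : Language.orderedExpRing.Functions 0) ts = 1 := by
  show func _ ts = func _ _
  congr 1; funext i; exact i.elim0

/-- `fnOf` is additive. [folklore] -/
theorem fnOf_add' (t₁ t₂ : Language.orderedExpRing.Term (k ⊕ Fin n)) :
    fnOf f n (t₁ + t₂) = fnOf f n t₁ + fnOf f n t₂ := Subtype.ext (funext fun x => by simp)

/-- `fnOf` is multiplicative. [folklore] -/
theorem fnOf_mul' (t₁ t₂ : Language.orderedExpRing.Term (k ⊕ Fin n)) :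
    fnOf f n (t₁ * t₂) = fnOf f n t₁ * fnOf f n t₂ := Subtype.ext (funext fun x => by simp)

/-- `fnOf` commutes with negation. [folklore] -/
theorem fnOf_neg' (t : Language.orderedExpRing.Term (k ⊕ Fin n)) :
    fnOf f n (-t) = -fnOf f n t := Subtype.ext (funext fun x => by simp)

/-- `fnOf 0 = 0`. [folklore] -/
theorem fnOf_zero' : fnOf f n (0 : Language.orderedExpRing.Term (k ⊕ Fin n)) = 0 :=
  Subtype.ext (funext fun x => by simp)

/-- `fnOf 1 = 1`. [folklore] -/
theorem fnOf_one' : fnOf f n (1 : Language.orderedExpRing.Term (k ⊕ Fin n)) = 1 :=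
  Subtype.ext (funext fun x => by simp)

/-- **The functions of a term along a chain adjoining its exponents**: if the exponents of the chain
from stage `n + a` on are the `expList` of `t`, then `fnOf t` lies at stage `n + a + |expList t|`,
and each listed exponent lies in the stage at which it is adjoined (admissibility). [folklore] -/
theorem mem_chain_of_expList (t : Language.orderedExpRing.Term (k ⊕ Fin n)) :
    ∀ (g : ℕ → termFnRing f n) (a : ℕ),
      (∀ b (hb : b < (expList f n t).length), g (n + a + b) = (expList f n t)[b]) →
      fnOf f n t ∈ chain f n g (n + a + (expList f n t).length) ∧
        ∀ b (hb : b < (expList f n t).length), (expList f n t)[b] ∈ chain f n g (n + a + b) := by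
  induction t with
  | var w =>
    intro g a _
    refine ⟨?_, fun b hb => by simp [expList] at hb⟩
    rcases w with c | i
    · exact constFn_mem_chain f n g c _
    · exact chain_mono f n g (by simp [expList]; omega) (coordFn_mem_chain f n g i)
  | func F ts ih =>
    intro g a hg
    cases F with
    | zero =>
      refine ⟨?_, fun b hb => by simp [expList] at hb⟩
      have : fnOf f n (func (expRingFunc.zero : Language.orderedExpRing.Functions 0) ts) = 0 := by
        rw [func_zero_eq, fnOf_zero']
      rw [this]; exact Subring.zero_mem _
    | one =>
      refine ⟨?_, fun b hb => by simp [expList] at hb⟩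
      have : fnOf f n (func (expRingFunc.one : Language.orderedExpRing.Functions 0) ts) = 1 := by
        rw [func_one_eq, fnOf_one']
      rw [this]; exact Subring.one_mem _
    | neg =>
      have hE : expList f n (func (expRingFunc.neg : Language.orderedExpRing.Functions 1) ts) = expList f n (ts 0) := rfl
      rw [hE] at hg ⊢
      obtain ⟨h0, h0'⟩ := ih 0 g a hg
      refine ⟨?_, h0'⟩
      have : fnOf f n (func (expRingFunc.neg : Language.orderedExpRing.Functions 1) ts) = -fnOf f n (ts 0) := by
        rw [func_neg_eq, fnOf_neg']
      rw [this]; exact Subring.neg_mem _ h0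
    | add =>
      have hE : expList f n (func (expRingFunc.add : Language.orderedExpRing.Functions 2) ts) =
          expList f n (ts 0) ++ expList f n (ts 1) := rfl
      rw [hE] at hg ⊢
      have hg0 : ∀ b (hb : b < (expList f n (ts 0)).length), g (n + a + b) = (expList f n (ts 0))[b] := by
        intro b hb
        rw [hg b (by simp; omega), List.getElem_append_left hb]
      have hg1 : ∀ b (hb : b < (expList f n (ts 1)).length),
          g (n + (a + (expList f n (ts 0)).length) + b) = (expList f n (ts 1))[b] := by
        intro b hb
        have := hg ((expList f n (ts 0)).length + b) (by simp; omega)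
        rw [show n + a + ((expList f n (ts 0)).length + b) = n + (a + (expList f n (ts 0)).length) + b by omega] at this
        rw [this, List.getElem_append_right (by omega)]
        simp
      obtain ⟨h0, h0'⟩ := ih 0 g a hg0
      obtain ⟨h1, h1'⟩ := ih 1 g (a + (expList f n (ts 0)).length) hg1
      refine ⟨?_, fun b hb => ?_⟩
      · have : fnOf f n (func (expRingFunc.add : Language.orderedExpRing.Functions 2) ts) =
            fnOf f n (ts 0) + fnOf f n (ts 1) := by
          rw [func_add_eq, fnOf_add']
        rw [this, List.length_append, ← add_assoc]
        refine Subring.add_mem _ (chain_mono f n g (by omega) h0) ?_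
        rw [show n + a + (expList f n (ts 0)).length = n + (a + (expList f n (ts 0)).length) by omega]
        exact h1
      · by_cases hb0 : b < (expList f n (ts 0)).length
        · rw [List.getElem_append_left hb0]; exact h0' b hb0
        · rw [List.getElem_append_right (by omega)]
          have := h1' (b - (expList f n (ts 0)).length) (by simp at hb; omega)
          rwa [show n + (a + (expList f n (ts 0)).length) + (b - (expList f n (ts 0)).length) = n + a + b by omega] at this
    | mul =>
      have hE : expList f n (func (expRingFunc.mul : Language.orderedExpRing.Functions 2) ts) =
          expList f n (ts 0) ++ expList f n (ts 1) := rfl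
      rw [hE] at hg ⊢
      have hg0 : ∀ b (hb : b < (expList f n (ts 0)).length), g (n + a + b) = (expList f n (ts 0))[b] := by
        intro b hb
        rw [hg b (by simp; omega), List.getElem_append_left hb]
      have hg1 : ∀ b (hb : b < (expList f n (ts 1)).length),
          g (n + (a + (expList f n (ts 0)).length) + b) = (expList f n (ts 1))[b] := by
        intro b hb
        have := hg ((expList f n (ts 0)).length + b) (by simp; omega)
        rw [show n + a + ((expList f n (ts 0)).length + b) = n + (a + (expList f n (ts 0)).length) + b by omega] at this
        rw [this, List.getElem_append_right (by omega)]
        simp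
      obtain ⟨h0, h0'⟩ := ih 0 g a hg0
      obtain ⟨h1, h1'⟩ := ih 1 g (a + (expList f n (ts 0)).length) hg1
      refine ⟨?_, fun b hb => ?_⟩
      · have : fnOf f n (func (expRingFunc.mul : Language.orderedExpRing.Functions 2) ts) =
            fnOf f n (ts 0) * fnOf f n (ts 1) := by
          rw [func_mul_eq, fnOf_mul']
        rw [this, List.length_append, ← add_assoc]
        refine Subring.mul_mem _ (chain_mono f n g (by omega) h0) ?_
        rw [show n + a + (expList f n (ts 0)).length = n + (a + (expList f n (ts 0)).length) by omega]
        exact h1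
      · by_cases hb0 : b < (expList f n (ts 0)).length
        · rw [List.getElem_append_left hb0]; exact h0' b hb0
        · rw [List.getElem_append_right (by omega)]
          have := h1' (b - (expList f n (ts 0)).length) (by simp at hb; omega)
          rwa [show n + (a + (expList f n (ts 0)).length) + (b - (expList f n (ts 0)).length) = n + a + b by omega] at this
    | exp =>
      have hE : expList f n (func (expRingFunc.exp : Language.orderedExpRing.Functions 1) ts) =
          expList f n (ts 0) ++ [fnOf f n (ts 0)] := rfl
      rw [hE] at hg ⊢
      have hg0 : ∀ b (hb : b < (expList f n (ts 0)).length), g (n + a + b) = (expList f n (ts 0))[b] := by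
        intro b hb
        rw [hg b (by simp; omega), List.getElem_append_left hb]
      obtain ⟨h0, h0'⟩ := ih 0 g a hg0
      have hgm : g (n + a + (expList f n (ts 0)).length) = fnOf f n (ts 0) := by
        rw [hg _ (by simp), List.getElem_append_right le_rfl]
        simp
      refine ⟨?_, fun b hb => ?_⟩
      · have : fnOf f n (func (expRingFunc.exp : Language.orderedExpRing.Functions 1) ts) =
            expFn f n (fnOf f n (ts 0)) := by
          rw [func_exp_eq, expFn_fnOf]
        rw [this, List.length_append, List.length_singleton, ← add_assoc, ← hgm,
          ← chainGen_of_le f n g (by omega)]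
        exact chainGen_mem f n g _
      · by_cases hb0 : b < (expList f n (ts 0)).length
        · rw [List.getElem_append_left hb0]; exact h0' b hb0
        · have hbeq : b = (expList f n (ts 0)).length := by simp at hb; omega
          subst hbeq
          rw [List.getElem_append_right le_rfl]
          simpa using h0

/-- **Every finite family of terms lies in a finitely generated admissible chain** (the tower of
p. 391, but only as far as needed, so that no enumeration of `k[x̄]ᵉ` is required). [cite: Wilkie1989, §3, p. 391] -/
theorem exists_admissible_chain {p : ℕ} (t : Fin p → Language.orderedExpRing.Term (k ⊕ Fin n)) :
    ∃ (g : ℕ → termFnRing f n) (J : ℕ), (∀ i, n ≤ i → g i ∈ chain f n g i) ∧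
      ∀ r, fnOf f n (t r) ∈ chain f n g (n + J) := by
  classical
  -- a list adjoining, family member by family member
  have key : ∀ (p : ℕ) (t : Fin p → Language.orderedExpRing.Term (k ⊕ Fin n)),
      ∃ L : List (termFnRing f n), ∀ (g : ℕ → termFnRing f n) (a : ℕ),
        (∀ b (hb : b < L.length), g (n + a + b) = L[b]) →
          (∀ r, fnOf f n (t r) ∈ chain f n g (n + a + L.length)) ∧
            ∀ b (hb : b < L.length), L[b] ∈ chain f n g (n + a + b) := by
    intro p
    induction p with
    | zero => intro t; exact ⟨[], fun g a _ => ⟨fun r => r.elim0, fun b hb => by simp at hb⟩⟩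
    | succ p ihp =>
      intro t
      obtain ⟨L, hL⟩ := ihp (Fin.init t)
      refine ⟨L ++ expList f n (t (Fin.last p)), fun g a hg => ?_⟩
      have hgL : ∀ b (hb : b < L.length), g (n + a + b) = L[b] := by
        intro b hb
        rw [hg b (by simp; omega), List.getElem_append_left hb]
      have hgE : ∀ b (hb : b < (expList f n (t (Fin.last p))).length),
          g (n + (a + L.length) + b) = (expList f n (t (Fin.last p)))[b] := by
        intro b hb
        have := hg (L.length + b) (by simp; omega)
        rw [show n + a + (L.length + b) = n + (a + L.length) + b by omega] at this
        rw [this, List.getElem_append_right (by omega)]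
        simp
      obtain ⟨h1, h1'⟩ := hL g a hgL
      obtain ⟨h2, h2'⟩ := mem_chain_of_expList (t (Fin.last p)) g (a + L.length) hgE
      refine ⟨fun r => ?_, fun b hb => ?_⟩
      · refine Fin.lastCases ?_ (fun r => ?_) r
        · exact chain_mono f n g (by simp only [List.length_append]; omega) h2
        · have := h1 r
          rw [Fin.init_def] at this
          exact chain_mono f n g (by simp only [List.length_append]; omega) this
      · by_cases hbL : b < L.length
        · rw [List.getElem_append_left hbL]; exact h1' b hbL
        · rw [List.getElem_append_right (by omega)]
          have := h2' (b - L.length) (by simp at hb; omega)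
          rwa [show n + (a + L.length) + (b - L.length) = n + a + b by omega] at this
  obtain ⟨L, hL⟩ := key p t
  have hg : ∀ b (hb : b < L.length), gOfList f n L (n + 0 + b) = L[b] := by
    intro b hb
    simp only [gOfList, add_zero, Nat.add_sub_cancel_left]
    rw [List.getD_eq_getElem _ _ hb]
  obtain ⟨h1, h2⟩ := hL (gOfList f n L) 0 hg
  refine ⟨gOfList f n L, L.length, fun i hi => ?_, fun r => by simpa using h1 r⟩
  by_cases hiL : i - n < L.length
  · have := h2 (i - n) hiL
    rw [show n + 0 + (i - n) = i by omega] at this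
    have hgi : gOfList f n L i = L[i - n] := by
      simp only [gOfList]; rw [List.getD_eq_getElem _ _ hiL]
    rwa [hgi]
  · have hgi : gOfList f n L i = 0 := by
      simp only [gOfList]; rw [List.getD_eq_default _ _ (by omega)]
    rw [hgi]; exact Subring.zero_mem _

end FiniteChain

end RealExpModel

/-! ### Theorem 2, §6: every e.a. point lies in `kⁿ` (modulo Khovanskii's finiteness theorem) -/

open RealExpModel in
/-- **Wilkie 1989, §6: the proof of Theorem 2 (discharge of the named fact
`Wilkie1989_expAlgebraicPoints_mem`).**  For models `k ⊆ K` of `T_exp` such that every e.a. point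
of `K` over `k` is bounded over `k`, every e.a. point of `K` over `k` lies in `kⁿ`.  The functions
of the defining terms lie in some stage `M_{n+h}` of an admissible chain
`k ⊆ k[x₁] ⊆ ⋯ ⊆ k[x̄] ⊆ k[x̄][e^{g}] ⊆ ⋯` (p. 391), and `RealExpModel.allStages` (the induction
on `(j, s)` of p. 403, whose step is Lemma 2 + Steps A, B + the curve argument with Lemmas 4, 6 and
transfer, pp. 403–407) applies.  Khovanskii's theorem [7] enters (as in the paper, p. 398 and
p. 406) through the finiteness of non-singular zero sets of square systems, now a theorem
(`KhovanskiiZeroBound.lean`, transferred in `Wilkie1989StepC.lean`). [cite: Wilkie1989, Theorem 2 (proof, §6, pp. 403–407)] -/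
theorem Wilkie1989_expAlgebraicPoints_mem_holds : Wilkie1989_expAlgebraicPoints_mem := by
  intro k K f hbd n α hα
  classical
  obtain ⟨F, hF0, hdet⟩ := hα
  -- the term functions lie in a common stage of an admissible chain
  obtain ⟨g, J, hg, hG⟩ := exists_admissible_chain (f := f) F
  -- `ᾱ` is a non-singular zero of the system of term functions
  have hαV : α ∈ VnsF f n (fun r => fnOf f n (F r)) := by
    rw [VnsF_eq_nonsingularZeroSet (fun r => rfl), mem_nonsingularZeroSet]
    refine ⟨fun r => hF0 r, ?_⟩
    have hmat : (Matrix.of fun r => grad (F r) (f : k → K) α) = jacobian F f α := by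
      ext i j; simp [grad_apply]
    have := (linearIndependent_rows_iff_det_ne_zero (Matrix.of fun r => grad (F r) (f : k → K) α)).2
      (by rw [hmat]; exact hdet)
    exact this
  exact allStages hbd J n g hg _ hG hαV

/-- The earlier conditional form (Khovanskii's Proposition as a hypothesis, now redundant), kept
under its landed name. [cite: Wilkie1989, Theorem 2 (proof, §6, pp. 403–407)] -/
theorem Wilkie1989_expAlgebraicPoints_mem_of_khovanskii (_H : Wilkie1989_khovanskiiProposition) :
    Wilkie1989_expAlgebraicPoints_mem :=
  Wilkie1989_expAlgebraicPoints_mem_holds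

end Literature.ModelTheory.ExponentialFields
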